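import Summits.ABC.StewartYu.ArchG3RecLinesOAtoms
import HarnessLib

/-!
# `ArchG3Rec` O-FAMILY letter lines — ATOMS B: the linear letters, the Feldman block, the `Y₀`-degree, and the two polynomial sizes
# `log WC`, `log DΔC` in the unit `Z`

Support file (theorems only; no named facts).  Cell `abc-stewartyu` (HOME `run/shared/lean/pub/abc-stewartyu/`), route `YuMatveevShapeRat`
(rung A1.L), crux r2 `ArchCoreRat` (stmt-ABC-20502), line `arch-g3-frame`, seam (B) of the last open stub `stub_recLinesArch`, plan R50
assignment «O (odd step): (J)+(C)+smallness → p2» (seat p2 g8).  Unit `Z = G·X·L`; p1's letter sheet `ArchG3RecLinesA–E`, p4's κ-twins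
`ArchG3RecLinesCK`; every helper of this family carries the suffix `O` (no collision with the other families' files).

* `letters_ZO` (`(n+1)L ≤ Z/1536`, `(n+1)²L ≤ Z/512`, `Tf₀₀·(n+1) ≤ (33/1024)Z`, `Tf₀₀·WN ≤ (33/128)Z`, `Tf₀₀ ≤ Z/93`), `H_lettersO` (`H ≤ X/8`,
  `X ≤ 16H`), `L₀_lettersO` (`L₀ ≤ Z/392 + 1`, `L₀·log N ≤ Z/40` by p1's `L₀_logN_le` — the `1/N` of the Siegel count kept, `L₀·(10n+35) ≤ Z/5`);
* `log_WC_le_ZO` — `log WC H ex L₀ Nord ρ ≤ (3/2)·Z` for `ex ≤ Ŝ`, `Nord ≤ Tf 0 0`, `2^ex·ρ ≤ 2^Ŝ·4X`;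
* `log_DΔC_le_ZO` — `log DΔC Y (Tf l ν) ≤ Z` for `0 ≤ Y ≤ yB·Bexp·N²·L`, `log yB ≤ 4n+8` (the `L` cancels against `Tf ≥ 8(n+1)L/(n+2)³`);
* `constsO`, `Tf00_H_le_ZO`.

WHAT THIS IS NOT: any line of the family; no crux moves.

## References
* [Nesterenko2003] Yu. V. Nesterenko, LNM 1819 (2003) — §4.2 (4.24)–(4.35) with the odd nodes `𝒳_{s,0}`, p. 87–90; §3.5 (3.22)–(3.25),
  Lemma 3.10 (3.35), Lemma 3.11 (3.42), (3.37).
-/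

noncomputable section

open Finset Real
open scoped Nat
open Summit.ABC.StewartYu.ArchSupply (WC)
open Summit.ABC.StewartYu.ArchG3Setup (DΔC)

namespace Summit.ABC.StewartYu

namespace ArchG3Rec

open PadicG3Par (Cb Cb_pos)
open ArchG3Par (G K yloadK G_eq G_pos K_pos yloadK_pos)

variable {n : ℕ} (P : ArchG3Rec n)

/-- linear letters in `Z` (`n ≥ 2`): `(n+1)·L ≤ Z/1536`, `(n+1)²·L ≤ Z/512`, `Tf₀₀·(n+1) ≤ (33/1024)·Z`, `Tf₀₀·WN ≤ (33/128)·Z`,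
`Tf₀₀ ≤ Z/93`, `0 ≤ Tf₀₀`. [folklore] -/
theorem letters_ZO (hn : 2 ≤ n) :
    ((n : ℝ) + 1) * P.L ≤ P.Z / 1536 ∧ ((n : ℝ) + 1) ^ 2 * P.L ≤ P.Z / 512 ∧
      (P.Tf 0 0 : ℝ) * ((n : ℝ) + 1) ≤ 33 / 1024 * P.Z ∧ (P.Tf 0 0 : ℝ) * P.WN ≤ 33 / 128 * P.Z ∧
      (P.Tf 0 0 : ℝ) ≤ P.Z / 93 ∧ (0 : ℝ) ≤ P.Tf 0 0 := by
  obtain ⟨hZ, hL, hXL, hLW, hnXL, hG⟩ := P.currenciesO hn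
  have hTf := P.Tf00_le hn
  have hn' : (2 : ℝ) ≤ n := by exact_mod_cast hn
  have hT0 : (0 : ℝ) ≤ P.Tf 0 0 := Nat.cast_nonneg _
  have hWN := P.WN_bounds.1
  have h1 : ((n : ℝ) + 1) * P.L ≤ P.Z / 1536 := by
    have h5 := mul_le_mul_of_nonneg_left hL (by positivity : (0:ℝ) ≤ (n:ℝ) + 1)
    have e : ((n : ℝ) + 1) * (P.Z / (512 * ((n : ℝ) + 1) ^ 2)) = P.Z / (512 * ((n : ℝ) + 1)) := by field_simp
    rw [e] at h5
    refine h5.trans ?_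
    rw [div_le_div_iff_of_pos_left hZ (by positivity) (by norm_num)]; linarith only [hn']
  have h2 : ((n : ℝ) + 1) ^ 2 * P.L ≤ P.Z / 512 := by
    have h5 := mul_le_mul_of_nonneg_left hL (by positivity : (0:ℝ) ≤ ((n:ℝ) + 1) ^ 2)
    have e : ((n : ℝ) + 1) ^ 2 * (P.Z / (512 * ((n : ℝ) + 1) ^ 2)) = P.Z / 512 := by field_simp
    linarith only [h5, e]
  have h3 : (P.Tf 0 0 : ℝ) * ((n : ℝ) + 1) ≤ 33 / 1024 * P.Z := by
    have h5 := mul_le_mul_of_nonneg_right hTf (by positivity : (0:ℝ) ≤ (n:ℝ) + 1)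
    have e : 33 / 2 * ((n : ℝ) + 1) * P.L * ((n : ℝ) + 1) = 33 / 2 * (((n : ℝ) + 1) ^ 2 * P.L) := by ring
    linarith only [h5, e, h2]
  have h4 : (P.Tf 0 0 : ℝ) * P.WN ≤ 33 / 128 * P.Z := by
    have h5 := mul_le_mul_of_nonneg_right hTf (by linarith : (0:ℝ) ≤ P.WN)
    have h6 := mul_le_mul_of_nonneg_left hLW (by positivity : (0:ℝ) ≤ (n:ℝ) + 1)
    have e : ((n : ℝ) + 1) * (P.Z / (64 * ((n : ℝ) + 1))) = P.Z / 64 := by field_simp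
    have e2 : 33 / 2 * ((n : ℝ) + 1) * P.L * P.WN = 33 / 2 * (((n : ℝ) + 1) * (P.L * P.WN)) := by ring
    linarith only [h5, h6, e, e2]
  have h5 : (P.Tf 0 0 : ℝ) ≤ P.Z / 93 := by
    have e : 33 / 2 * ((n : ℝ) + 1) * P.L = 33 / 2 * (((n : ℝ) + 1) * P.L) := by ring
    linarith only [hTf, h1, e]
  exact ⟨h1, h2, h3, h4, h5, hT0⟩

/-- the Feldman block: `H ≤ X/8`, `X ≤ 16·H`, `1 ≤ H`. [folklore] -/
theorem H_lettersO : (P.H : ℝ) ≤ P.X / 8 ∧ (P.X : ℝ) ≤ 16 * P.H ∧ (1 : ℝ) ≤ P.H := by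
  obtain ⟨hH1, hHle, hHge⟩ := P.H_bounds
  have hGe : G n = 8 * (n + 1) := G_eq n
  rw [hGe] at hHle hHge
  have hn1 : (0 : ℝ) < (n : ℝ) + 1 := by positivity
  refine ⟨hHle.trans (le_of_eq ?_), ?_, hH1⟩
  · field_simp; ring
  · have e : 8 * ((n : ℝ) + 1) * P.X / (128 * (n + 1)) = P.X / 16 := by field_simp; ring
    rw [e] at hHge; linarith only [hHge]

/-- the `L₀`-letters in `Z` (`n ≥ 2`): `L₀ ≤ Z/392 + 1`, `L₀·log N ≤ Z/40`, `L₀·(10n+35) ≤ Z/5`, `0 ≤ L₀`. [folklore] -/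
theorem L₀_lettersO (hn : 2 ≤ n) :
    (P.L₀ : ℝ) ≤ P.Z / 392 + 1 ∧ (P.L₀ : ℝ) * Real.log P.N ≤ P.Z / 40 ∧ (P.L₀ : ℝ) * (10 * n + 35) ≤ P.Z / 5 ∧
      0 ≤ (P.L₀ : ℝ) := by
  have hL0N := P.L₀_logN_le
  have hL0Z := P.L₀_real_le.2.2
  have hL00 : (0 : ℝ) ≤ P.L₀ := Nat.cast_nonneg _
  have hlogN := P.WN_bounds.2.2.1
  have hy98 : (98 : ℝ) ≤ yloadK n := by
    have := yloadK_ge (n := n) (by omega); have hG' : G n = 8 * (n + 1) := G_eq n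
    have hn2 : (2 : ℝ) ≤ n := by exact_mod_cast hn
    nlinarith
  obtain ⟨hnL, -, -, -, -, -⟩ := P.letters_ZO hn
  obtain ⟨-, -, -, -, hWNZ, -⟩ := P.currenciesO' hn
  have hZ := P.Z_floors.1
  have hy0 : 0 < yloadK n := yloadK_pos n
  have hn' : (2 : ℝ) ≤ n := by exact_mod_cast hn
  have hGe : G n = 8 * (n + 1) := G_eq n
  have h1 : (P.L₀ : ℝ) ≤ P.Z / 392 + 1 := by
    have : P.Z / (4 * yloadK n) ≤ P.Z / 392 := div_le_div_of_nonneg_left hZ.le (by norm_num) (by linarith only [hy98])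
    linarith only [this, hL0Z]
  have h2 : (P.L₀ : ℝ) * Real.log P.N ≤ P.Z / 40 := by
    have h3 : P.Z / (2 * yloadK n) ≤ P.Z * (1 / 196) := by
      rw [div_le_iff₀ (by positivity)]
      nlinarith only [hZ, hy98]
    calc (P.L₀ : ℝ) * Real.log P.N ≤ P.Z / (2 * yloadK n) + Real.log P.N := hL0N
      _ ≤ P.Z * (1 / 196) + P.Z / 192 := add_le_add h3 (hlogN.trans hWNZ)
      _ ≤ P.Z / 40 := by linarith only [hZ]
  have h3 : (P.L₀ : ℝ) * (10 * n + 35) ≤ P.Z / 5 := by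
    have hyl : 24 * (n : ℝ) + 50 ≤ yloadK n := by
      have := yloadK_ge (n := n) (by omega); rw [hGe] at this; linarith
    have h1' : (P.L₀ : ℝ) * (10 * n + 35) ≤ (P.Z / (4 * yloadK n) + 1) * (10 * n + 35) :=
      mul_le_mul_of_nonneg_right hL0Z (by positivity)
    have h2' : P.Z / (4 * yloadK n) * (10 * n + 35) ≤ P.Z * (5 / 32) := by
      rw [div_mul_eq_mul_div, div_le_iff₀ (by positivity)]
      have hc : (10 : ℝ) * n + 35 ≤ 5 / 32 * (4 * yloadK n) := by linarith only [hyl, hn']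
      have h5 := mul_le_mul_of_nonneg_left hc hZ.le
      have e : P.Z * (5 / 32 * (4 * yloadK n)) = P.Z * (5 / 32) * (4 * yloadK n) := by ring
      linarith only [h5, e]
    have h3' : (10 : ℝ) * n + 35 ≤ 15 * (((n : ℝ) + 1) * P.L) := by
      have hL4 : (4 : ℝ) ≤ P.L := by
        have h := P.L_real.2.2.1
        have : (4 : ℝ) ≤ 2 ^ (n + 25) := by
          calc (4 : ℝ) = 2 ^ 2 := by norm_num
            _ ≤ 2 ^ (n + 25) := pow_le_pow_right₀ (by norm_num) (by omega)
        linarith only [h, this]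
      have h5 := mul_le_mul_of_nonneg_left hL4 (by positivity : (0:ℝ) ≤ 15 * ((n : ℝ) + 1))
      have hn0 : (0 : ℝ) ≤ n := Nat.cast_nonneg n
      have e : 15 * ((n : ℝ) + 1) * P.L = 15 * (((n : ℝ) + 1) * P.L) := by ring
      linarith only [h5, hn0, hn', e]
    have e' : (P.Z / (4 * yloadK n) + 1) * (10 * (n : ℝ) + 35) = P.Z / (4 * yloadK n) * (10 * n + 35) + (10 * n + 35) := by ring
    linarith only [h1', h2', h3', hnL, e']
  exact ⟨h1, h2, h3, hL00⟩

/-- **the Hasse-weight size in `Z`**: for `ex ≤ Ŝ`, `Nord ≤ Tf 0 0` and a radius with `2^ex·ρ ≤ 2^Ŝ·4X`,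
`log WC H ex L₀ Nord ρ ≤ (3/2)·Z` (`Ŝ·Tf₀₀·log 2 ≤ Tf₀₀·(10n+29+log N)`, `H/e ≤ X/8`, `L₀·(1 + log(1 + 64·2^Ŝ)) ≤ L₀·(10n+35) + L₀·log N`).
[cite: Nesterenko2003, §3.5 Lemma 3.10 (3.35); shape only] -/
theorem log_WC_le_ZO (hn : 2 ≤ n) {ex Nord : ℕ} (hex : ex ≤ P.Sd) (hNord : Nord ≤ P.Tf 0 0) {ρ : ℝ} (hρ : 0 ≤ ρ)
    (h2ρ : (2 : ℝ) ^ ex * ρ ≤ 2 ^ P.Sd * (4 * P.X)) :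
    Real.log (WC P.H ex P.L₀ Nord ρ) ≤ 3 / 2 * P.Z := by
  rw [log_WC_eqO P.H ex P.L₀ Nord hρ]
  obtain ⟨hnL, hsqL, hTfn, hTfW, hTfZ, hT0⟩ := P.letters_ZO hn
  obtain ⟨-, -, hXZ, -, hWNZ, -⟩ := P.currenciesO' hn
  obtain ⟨hL01, hL0N, hL0n, hL00⟩ := P.L₀_lettersO hn
  obtain ⟨hHX, hXH, hH1⟩ := P.H_lettersO
  obtain ⟨-, hSd2⟩ := P.Sd_log_le
  obtain ⟨hWN1, hWWN, hlogN, hWN0⟩ := P.WN_bounds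
  have hn' : (2 : ℝ) ≤ n := by exact_mod_cast hn
  -- (1) `ex·Nord·log 2 ≤ Sd·log 2·Tf00 ≤ (10n + 29 + WN)·Tf00`
  have h1 : ((ex * Nord : ℕ) : ℝ) * Real.log 2 ≤ (P.Tf 0 0 : ℝ) * (10 * ((n : ℝ) + 1)) + 19 * P.Tf 0 0 + P.Tf 0 0 * P.WN := by
    have hexN : ((ex * Nord : ℕ) : ℝ) ≤ (P.Sd : ℝ) * P.Tf 0 0 := by
      have : ex * Nord ≤ P.Sd * P.Tf 0 0 := Nat.mul_le_mul hex hNord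
      exact_mod_cast this
    have hl2 : 0 ≤ Real.log 2 := (Real.log_pos one_lt_two).le
    have hS := mul_le_mul_of_nonneg_right hexN hl2
    have hS' : (P.Sd : ℝ) * P.Tf 0 0 * Real.log 2 = ((P.Sd : ℝ) * Real.log 2) * P.Tf 0 0 := by ring
    have hS2 := mul_le_mul_of_nonneg_right (show (P.Sd : ℝ) * Real.log 2 ≤ 10 * n + 29 + P.WN by linarith only [hSd2, hlogN]) hT0
    have e : (10 * (n : ℝ) + 29 + P.WN) * P.Tf 0 0 = (P.Tf 0 0 : ℝ) * (10 * ((n : ℝ) + 1)) + 19 * P.Tf 0 0 + P.Tf 0 0 * P.WN := by ring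
    linarith only [hS, hS', hS2, e]
  -- (2) `H/e ≤ H ≤ X/8`
  have h2 : (P.H : ℝ) / Real.exp 1 ≤ P.X / 8 := by
    have he : 1 ≤ Real.exp 1 := Real.one_le_exp (by norm_num)
    have : (P.H : ℝ) / Real.exp 1 ≤ P.H := div_le_self (by linarith only [hH1]) he
    linarith only [this, hHX]
  -- (3) `L₀·(1 + log(1 + 2^ex ρ/H)) ≤ L₀·(10n + 35) + L₀·log N`
  have h3 : (P.L₀ : ℝ) * (1 + Real.log (1 + (2 : ℝ) ^ ex * ρ / P.H)) ≤ (P.L₀ : ℝ) * (10 * n + 35) + P.L₀ * Real.log P.N := by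
    have hq : (2 : ℝ) ^ ex * ρ / P.H ≤ 64 * 2 ^ P.Sd := by
      rw [div_le_iff₀ (by linarith only [hH1])]
      have h5 := mul_le_mul_of_nonneg_left hXH (show (0:ℝ) ≤ 2 ^ P.Sd * 4 by positivity)
      linarith only [h2ρ, h5]
    have hlog : Real.log (1 + (2 : ℝ) ^ ex * ρ / P.H) ≤ 5 + P.Sd * Real.log 2 := by
      have h65 : 1 + (2 : ℝ) ^ ex * ρ / P.H ≤ 65 * 2 ^ P.Sd := by
        have : (1 : ℝ) ≤ 2 ^ P.Sd := one_le_pow₀ (by norm_num); linarith only [this, hq]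
      have hpos : 0 < 1 + (2 : ℝ) ^ ex * ρ / P.H := by have : (0:ℝ) < P.H := by linarith only [hH1]
                                                       positivity
      calc Real.log (1 + (2 : ℝ) ^ ex * ρ / P.H) ≤ Real.log (65 * 2 ^ P.Sd) := Real.log_le_log hpos h65
        _ = Real.log 65 + P.Sd * Real.log 2 := by rw [Real.log_mul (by norm_num) (by positivity), Real.log_pow]
        _ ≤ 5 + P.Sd * Real.log 2 := by
            have : Real.log 65 ≤ 5 := by
              have he := Real.exp_one_gt_d9
              have e5 : Real.exp 1 ^ 5 = Real.exp 5 := by rw [Real.exp_one_pow]; norm_num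
              have hp : (2.7182818283 : ℝ) ^ 5 ≤ Real.exp 1 ^ 5 := pow_le_pow_left₀ (by norm_num) he.le 5
              have hc : (65 : ℝ) ≤ (2.7182818283 : ℝ) ^ 5 := by norm_num
              calc Real.log 65 ≤ Real.log (Real.exp 5) := Real.log_le_log (by norm_num) (by rw [← e5]; linarith)
                _ = 5 := Real.log_exp 5
            linarith only [this]
    have h6 : 1 + Real.log (1 + (2 : ℝ) ^ ex * ρ / P.H) ≤ 10 * n + 35 + Real.log P.N := by linarith only [hlog, hSd2]
    have h7 := mul_le_mul_of_nonneg_left h6 hL00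
    have e : (P.L₀ : ℝ) * (10 * n + 35 + Real.log P.N) = (P.L₀ : ℝ) * (10 * n + 35) + P.L₀ * Real.log P.N := by ring
    linarith only [h7, e]
  -- assemble: `Tf00·10(n+1) ≤ (330/1024)Z`, `19·Tf00 ≤ (19/93)Z`, `Tf00·WN ≤ (33/128)Z`, `X/8 ≤ Z/192`, `L₀-terms ≤ Z/5 + Z/40`
  linarith only [h1, h2, h3, hTfn, hTfW, hTfZ, hXZ, hL0N, hL0n]

/-- **the Δ-weight size in `Z`** at any record order `T′ = Tf l ν`: for `0 ≤ Y ≤ yB·Bexp·N²·L` with `1 ≤ yB`, `log yB ≤ 4n + 8`,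
`log DΔC Y (Tf l ν) ≤ Z` (`Y/T′ ≤ yB·Bexp·N²·(n+2)³` — the `L` cancels against `T′ ≥ 8(n+1)L/(n+2)³` — then `T′ ≤ Tf 0 0 ≤ (33/2)(n+1)L`).
[cite: Nesterenko2003, §3.5 (3.37); shape only] -/
theorem log_DΔC_le_ZO (hn : 2 ≤ n) {yB Y : ℝ} (hyB : 1 ≤ yB) (hlyB : Real.log yB ≤ 4 * n + 8) (hY0 : 0 ≤ Y)
    (hY : Y ≤ yB * P.Bexp * P.N ^ 2 * P.L) (l ν : ℕ) :
    Real.log (DΔC Y (P.Tf l ν)) ≤ P.Z := by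
  rw [log_DΔC_eqO hY0]
  obtain ⟨hnL, hsqL, hTfn, hTfW, hTfZ, hT00⟩ := P.letters_ZO hn
  obtain ⟨hWN1, hWWN, hlogN, hWN0⟩ := P.WN_bounds
  obtain ⟨hTfge, hTf1⟩ := P.Tf_ge l ν
  have hTf' : (P.Tf l ν : ℝ) ≤ P.Tf 0 0 := by exact_mod_cast P.Tf_le_Tf00 l ν
  have hB1 := P.Alast_facts.2.2.2.2.2
  have hN := P.N_facts
  have hL1 := P.L_real
  have hn' : (2 : ℝ) ≤ n := by exact_mod_cast hn
  set V : ℝ := yB * P.Bexp * P.N ^ 2 with hV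
  have hN2 : (1 : ℝ) ≤ P.N ^ 2 := one_le_pow₀ hN.2.1
  have hV1 : 1 ≤ V := by
    rw [hV]
    calc (1 : ℝ) = 1 * 1 * 1 := by ring
      _ ≤ yB * P.Bexp * P.N ^ 2 := by gcongr
  have hV0 : 0 < V := by linarith only [hV1]
  have hn20 : (0 : ℝ) < ((n : ℝ) + 2) ^ 3 := by positivity
  -- `Y/T' ≤ V·(n+2)³`
  have hq : Y / P.Tf l ν ≤ V * ((n : ℝ) + 2) ^ 3 := by
    rw [div_le_iff₀ (by linarith only [hTf1])]
    have h8 : (0 : ℝ) < 8 * ((n : ℝ) + 1) := by positivity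
    -- `Y·8(n+1) ≤ V·L·8(n+1) ≤ V·(n+2)³·Tf`
    have hY' : Y ≤ V * P.L := by rw [hV]; linarith only [hY]
    have h9 := mul_le_mul_of_nonneg_left hTfge hV0.le
    have h10 := mul_le_mul_of_nonneg_right hY' h8.le
    have e1 : V * (8 * ((n : ℝ) + 1) * P.L) = V * P.L * (8 * ((n : ℝ) + 1)) := by ring
    have e2 : V * (((n : ℝ) + 2) ^ 3 * P.Tf l ν) = V * ((n : ℝ) + 2) ^ 3 * P.Tf l ν := by ring
    have h11 : Y * (8 * ((n : ℝ) + 1)) ≤ V * ((n : ℝ) + 2) ^ 3 * P.Tf l ν := by linarith only [h9, h10, e1, e2]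
    -- divide by `8(n+1) ≥ 1`
    have hT0 : (0:ℝ) ≤ V * ((n : ℝ) + 2) ^ 3 * P.Tf l ν := by positivity
    nlinarith only [h11, hT0, h8, hn']
  have hlog : Real.log (1 + Y / P.Tf l ν) ≤ 7 * n + 11 + 2 * P.WN := by
    have h13 : (1 : ℝ) ≤ ((n : ℝ) + 2) ^ 3 := one_le_pow₀ (by linarith only [hn'])
    have h2 : 1 + Y / P.Tf l ν ≤ 2 * (V * ((n : ℝ) + 2) ^ 3) := by
      have : (1 : ℝ) ≤ V * ((n : ℝ) + 2) ^ 3 := by nlinarith only [hV1, h13]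
      linarith only [this, hq]
    have hpos : 0 < 1 + Y / P.Tf l ν := by positivity
    have hexp : Real.log (2 * (V * ((n : ℝ) + 2) ^ 3)) =
        Real.log 2 + (Real.log yB + Real.log P.Bexp + 2 * Real.log P.N) + 3 * Real.log ((n : ℝ) + 2) := by
      have hyB0 : 0 < yB := by linarith only [hyB]
      have hBe0 : 0 < P.Bexp := by linarith only [hB1]
      have hN2' : 0 < (P.N : ℝ) ^ 2 := pow_pos hN.1 2
      rw [Real.log_mul (by norm_num) (mul_pos hV0 hn20).ne', Real.log_mul hV0.ne' hn20.ne', Real.log_pow, hV,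
        Real.log_mul (mul_pos hyB0 hBe0).ne' hN2'.ne', Real.log_mul hyB0.ne' hBe0.ne', Real.log_pow]
      push_cast; ring
    have hl2 : Real.log 2 < 1 := by have := Real.log_two_lt_d9; linarith
    have hB : Real.log P.Bexp = P.W - 1 := by unfold Bexp; exact Real.log_exp _
    have hn2 : Real.log ((n : ℝ) + 2) ≤ (n : ℝ) + 1 := by
      have := Real.log_le_sub_one_of_pos (show (0:ℝ) < (n:ℝ) + 2 by positivity); linarith
    have hWNdef : P.WN = P.W + Real.log P.N := rfl
    calc Real.log (1 + Y / P.Tf l ν) ≤ Real.log (2 * (V * ((n : ℝ) + 2) ^ 3)) := Real.log_le_log hpos h2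
      _ = Real.log 2 + (Real.log yB + Real.log P.Bexp + 2 * Real.log P.N) + 3 * Real.log ((n : ℝ) + 2) := hexp
      _ ≤ 7 * n + 11 + 2 * P.WN := by rw [hB]; linarith only [hl2, hlyB, hn2, hWNdef, hlogN]
  -- `Tf'·(1 + 7n + 11 + 2WN) ≤ Tf00·(7n+12) + Tf00·2WN ≤ 7·Tf00·(n+1) + 5·Tf00 + 2·Tf00·WN`
  have hT0 : (0 : ℝ) ≤ P.Tf l ν := by linarith only [hTf1]
  have h1a := mul_le_mul_of_nonneg_left (show 1 + Real.log (1 + Y / P.Tf l ν) ≤ 7 * n + 12 + 2 * P.WN by linarith only [hlog]) hT0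
  have hpos : (0 : ℝ) ≤ 7 * n + 12 + 2 * P.WN := by positivity
  have h1b : (P.Tf l ν : ℝ) * (7 * n + 12 + 2 * P.WN) ≤ (P.Tf 0 0 : ℝ) * (7 * n + 12 + 2 * P.WN) :=
    mul_le_mul_of_nonneg_right hTf' hpos
  have e : (P.Tf 0 0 : ℝ) * (7 * n + 12 + 2 * P.WN) = 7 * ((P.Tf 0 0 : ℝ) * ((n : ℝ) + 1)) + 5 * P.Tf 0 0 + 2 * (P.Tf 0 0 * P.WN) := by
    ring
  linarith only [h1a, h1b, e, hTfn, hTfZ, hTfW]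

/-- constants in `Z` (`n ≥ 2`): `10n + 35 ≤ Z/100`, `1 ≤ Z/4608`, `log 3 ≤ 2`, `log 2 ≤ 1`, `256 ≤ 2^{4n}`. [folklore] -/
theorem constsO (hn : 2 ≤ n) : (10 : ℝ) * n + 35 ≤ P.Z / 100 ∧ (1 : ℝ) ≤ P.Z / 4608 ∧ Real.log 3 ≤ 2 ∧ Real.log 2 ≤ 1 ∧
    (256 : ℝ) ≤ 2 ^ (4 * n) := by
  obtain ⟨hnL, -, -, -, -, -⟩ := P.letters_ZO hn
  obtain ⟨hLZ, -, -, -, -, hZ1⟩ := P.currenciesO' hn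
  have hn' : (2 : ℝ) ≤ n := by exact_mod_cast hn
  have h1 : (10 : ℝ) * n + 35 ≤ P.Z / 100 := by
    have hL4 : (4 : ℝ) ≤ P.L := by
      have h := P.L_real.2.2.1
      have : (4 : ℝ) ≤ 2 ^ (n + 25) := by
        calc (4 : ℝ) = 2 ^ 2 := by norm_num
          _ ≤ 2 ^ (n + 25) := pow_le_pow_right₀ (by norm_num) (by omega)
      linarith only [h, this]
    have h5 := mul_le_mul_of_nonneg_left hL4 (by positivity : (0:ℝ) ≤ 15 * ((n : ℝ) + 1))
    have hn0 : (0 : ℝ) ≤ n := Nat.cast_nonneg n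
    have e : 15 * ((n : ℝ) + 1) * P.L = 15 * (((n : ℝ) + 1) * P.L) := by ring
    linarith only [h5, hn0, hn', e, hnL]
  have h3 : Real.log 3 ≤ 2 := by have := Real.log_le_sub_one_of_pos (show (0:ℝ) < 3 by norm_num); linarith
  have h2 : Real.log 2 ≤ 1 := by have := Real.log_two_lt_d9; linarith
  have h4 : (256 : ℝ) ≤ 2 ^ (4 * n) := by
    calc (256 : ℝ) = 2 ^ 8 := by norm_num
      _ ≤ 2 ^ (4 * n) := pow_le_pow_right₀ (by norm_num) (by omega)
  exact ⟨h1, by linarith only [hLZ, P.L_real.1], h3, h2, h4⟩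

/-- `Tf 0 0 · H ≤ (33/128)·Z`. [folklore] -/
theorem Tf00_H_le_ZO (hn : 2 ≤ n) : (P.Tf 0 0 : ℝ) * P.H ≤ 33 / 128 * P.Z := by
  obtain ⟨hZ, hL, hXL, hLW, hnXL, hG⟩ := P.currenciesO hn
  obtain ⟨hHX, -, hH1⟩ := P.H_lettersO
  have hTf := P.Tf00_le hn
  have hT0 : (0 : ℝ) ≤ P.Tf 0 0 := Nat.cast_nonneg _
  have h1 := mul_le_mul_of_nonneg_left hHX hT0
  have h2 := mul_le_mul_of_nonneg_right hTf (by positivity : (0 : ℝ) ≤ P.X / 8)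
  have e : 33 / 2 * ((n : ℝ) + 1) * P.L * (P.X / 8) = 33 / 16 * (((n : ℝ) + 1) * (P.X * P.L)) := by ring
  linarith only [h1, h2, e, hnXL]

end ArchG3Rec

end Summit.ABC.StewartYu

end
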